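import Literature.Combinatorics.Enumerative.SetFunctionConvolution
import HarnessLib

/-!
# Set-function convolution and the Linnik function: relabelling invariance

Everything PROVED; continuation of `SetFunctionConvolution.lean`. For an injection `ι : α ↪ α'`:
`spow_comp_map` (`(F ∘ map ι)^{⋆d}(S) = F^{⋆d}(ι S)`), `smallFn_map`, `spow_smallFn_map`,
`linnikFn_eq_sum_Icc_card` (the Linnik function may be truncated at `|A|`), and
**`linnikFn_map`**: `𝓛_c((x' ∘ ι)_S) = 𝓛_c(x'_{ι S})` — Ford–Maynard's `𝓛_c(x)` depends only on the
multiset of coordinates of the subvector (arXiv:2407.14368, Definition (Linnik-fcn), §5.1); the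
special cases `linnikFn_comp_perm`, `spow_linnikFn_comp_perm` (coordinate permutations) are the
form used when symmetrising slice integrals (Theorem 6.4).
-/

noncomputable section

open Finset

namespace Literature.Combinatorics.Enumerative

section Relabel

variable {α α' : Type*} [DecidableEq α] [DecidableEq α']

/-- Pulling a set function back along an embedding commutes with convolution powers:
`(F ∘ map ι)^{⋆d}(S) = F^{⋆d}(ι S)`. [folklore] -/
theorem spow_comp_map (ι : α ↪ α') (F : Finset α' → ℝ) :
    ∀ (d : ℕ) (S : Finset α), spow (fun B => F (B.map ι)) d S = spow F d (S.map ι)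
  | 0, S => by simp [spow_zero, sdelta, Finset.map_eq_empty]
  | d + 1, S => by
    rw [spow_succ, spow_succ, sconv, sconv]
    refine Finset.sum_nbij' (fun B => B.map ι) (fun C => S.filter fun a => ι a ∈ C) ?_ ?_ ?_ ?_ ?_
    · intro B hB
      rw [Finset.mem_powerset] at hB ⊢
      exact map_subset_map.2 hB
    · intro C _
      rw [Finset.mem_powerset]
      exact filter_subset _ _
    · intro B hB
      rw [Finset.mem_powerset] at hB
      ext a
      simp only [mem_filter, mem_map']
      exact ⟨fun h => h.2, fun h => ⟨hB h, h⟩⟩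
    · intro C hC
      rw [Finset.mem_powerset] at hC
      ext y
      simp only [mem_map, mem_filter]
      constructor
      · rintro ⟨a, ⟨_, ha⟩, rfl⟩; exact ha
      · intro hy
        obtain ⟨a, haS, rfl⟩ := mem_map.1 (hC hy)
        exact ⟨a, ⟨haS, hy⟩, rfl⟩
    · intro B hB
      rw [Finset.mem_powerset] at hB
      rw [spow_comp_map ι F d (S \ B), Finset.map_sdiff]

omit [DecidableEq α] [DecidableEq α'] in
/-- `smallFn` is natural under relabelling. [folklore] -/
theorem smallFn_map (ι : α ↪ α') (c : ℝ) (x' : α' → ℝ) (B : Finset α) :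
    smallFn c (x' ∘ ι) B = smallFn c x' (B.map ι) := by
  unfold smallFn
  rw [Finset.sum_map]
  simp only [Function.comp, Finset.map_nonempty]

/-- Convolution powers of `smallFn` are natural under relabelling. [folklore] -/
theorem spow_smallFn_map (ι : α ↪ α') (c : ℝ) (x' : α' → ℝ) (d : ℕ) (S : Finset α) :
    spow (smallFn c (x' ∘ ι)) d S = spow (smallFn c x') d (S.map ι) := by
  rw [← spow_comp_map ι (smallFn c x') d S]
  congr 1
  funext B
  exact smallFn_map ι c x' B

/-- The Linnik function may be truncated at `|A|`. [folklore] -/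
theorem linnikFn_eq_sum_Icc_card [Fintype α] (c : ℝ) (x : α → ℝ) (A : Finset α) :
    linnikFn c x A = ∑ j ∈ Finset.Icc 1 A.card, wLinnik j * spow (smallFn c x) j A := by
  unfold linnikFn
  refine (Finset.sum_subset (Finset.Icc_subset_Icc_right (Finset.card_le_univ A)) ?_).symm
  intro j hj hjA
  simp only [Finset.mem_Icc, not_and, not_le] at hj hjA
  rw [spow_eq_zero_of_card_lt (smallFn_empty c x) (hjA hj.1), mul_zero]

/-- **Relabelling invariance of the Linnik function**: for an injection `ι : α ↪ α'` and
`x = x' ∘ ι`, `𝓛_c(x_S) = 𝓛_c(x'_{ι S})`. [folklore] -/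
theorem linnikFn_map [Fintype α] [Fintype α'] (ι : α ↪ α') (c : ℝ) (x' : α' → ℝ) (S : Finset α) :
    linnikFn c (x' ∘ ι) S = linnikFn c x' (S.map ι) := by
  rw [linnikFn_eq_sum_Icc_card, linnikFn_eq_sum_Icc_card, Finset.card_map]
  refine Finset.sum_congr rfl fun j _ => ?_
  rw [spow_smallFn_map]

/-- Relabelling by a permutation. [folklore] -/
theorem linnikFn_comp_perm [Fintype α] (σ : Equiv.Perm α) (c : ℝ) (x : α → ℝ) (S : Finset α) :
    linnikFn c (x ∘ σ) S = linnikFn c x (S.map σ.toEmbedding) :=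
  linnikFn_map σ.toEmbedding c x S

/-- Relabelling by a permutation, convolution powers of the Linnik set function
`A ↦ 𝓛_c(x_A)`. [folklore] -/
theorem spow_linnikFn_comp_perm [Fintype α] (σ : Equiv.Perm α) (c : ℝ) (x : α → ℝ) (d : ℕ)
    (S : Finset α) :
    spow (linnikFn c (x ∘ σ)) d S = spow (linnikFn c x) d (S.map σ.toEmbedding) := by
  rw [← spow_comp_map σ.toEmbedding (linnikFn c x) d S]
  congr 1
  funext B
  exact linnikFn_comp_perm σ c x B

/-- `F^{⋆(d+1)} = F^{⋆d} ⋆ F`. [folklore] -/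
theorem spow_succ' (F : Finset α → ℝ) (d : ℕ) : spow F (d + 1) = sconv (spow F d) F := by
  rw [spow_succ, sconv_comm]

end Relabel

end Literature.Combinatorics.Enumerative
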